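import Mathlib
import HarnessLib
import Summits.HodgeConjecture.HodgeConjecture.Theses.PadicSemiregularLift
import Summits.HodgeConjecture.HodgeConjecture.Theses.QbarEnvelope
import Summits.HodgeConjecture.HodgeConjecture.Theses.AdelicCoherence
import Summits.HodgeConjecture.HodgeConjecture.Theorems.PadicSemiregularLiftAnchorsAtGenericHodgeLocusPointsFermatAnchorReduction
import Literature.AlgebraicGeometry.Motives.CrystallineTateClasses
import Literature.AlgebraicGeometry.HodgeTheory.AtiyahClassTraceReal

/-!
# Sketch — crux-ideate stmt-HodgeConjecture-14054 (`HodgeBeyondAnchors`), round 2, ideator 5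

First lemmas of the crux idea card `coherent-plane-object-engine`
("No remainder: run the object engine where the summit's ℚ̄-funnel ends"), over EXISTING declarations.

§1  Model-wise vocabulary of the new stub.  `IsCoherentAt C 𝒳 r α`: the de Rham class `α` of the generic
    fibre of a `W(k)`-model lies in `Fʳ` and its Berthelot–Ogus preimage in the `K`-span of crystalline Tate
    classes of the special fibre — the model-wise shape of the hypotheses of
    `AdelicCoherence.CoherentClassesAlgebraic` (de Rham-rational Hodge plane + potentially Tate) at ONE good
    place.  `SemiregularSeedSpanAt` (verbatim the ideator-1 typing): `α` is in the `K`-span of `bo chᵣ` of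
    `{0,1}`-semiregular finite locally free seeds with the Bloch–Esnault–Kerz Hodge condition.
    `CoherentSeedsAt C 𝒳 r`: every coherent class at this model is seed-spanned — the model-wise instance of the
    card's number-field stub `NumberFieldSeeds` ("… at SOME good place v").
§2  Proved: seeds ⇒ coherent (`isCoherentAt_of_seedSpan`, necessity: the stub asks nothing absurd), and the
    ENGINE OUTPUT `coherent_mem_span_ratAlgebraicClasses`: `CoherentSeedsAt` + (every semiregular seed with the Hodge
    condition lifts to `𝒳` — the route's P1b → P1a → P3a at this model) ⇒ every coherent class is a `K`-combination
    of `ℚ`-algebraic de Rham classes of `X_K` (the input of descent).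
§3  Proved WIRING (the composition that the dead line `Sketch` lacked, concluding the crux BY NAME from typed items
    of the summit): `hodgeBeyondAnchors_of_funnel : Envelope → PullbackAlgebraic → HodgeModels → HCOverNumberFields →
    HodgeBeyondAnchors` (QbarEnvelope's deciding theorem restricted off the anchors) and
    `hcOverNumberFields_of_hodgeConjectureNumberFields : AdelicCoherence.HodgeConjectureNumberFields →
    QbarEnvelope.HCOverNumberFields` (transport along `X ≅ X₀ ⊗_σ ℂ`), so that the crux sits under
    `Envelope ∧ PullbackAlgebraic ∧ HodgeModels ∧ HodgeConjectureNumberFields`, and the last is where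
    `DeRhamPlanes ∧ FrobeniusPlanes ∧ NumberFieldSeeds ∧ engine` act.
-/

namespace Summit.HodgeConjecture.HodgeConjecture.Cruxes.HodgeBeyondAnchors.IdeatorFiveSketch

open Literature.AlgebraicGeometry.Motives Literature.AlgebraicGeometry.Motives.WittScheme
open Literature.AlgebraicGeometry.HodgeTheory
open scoped Isocrystal

noncomputable section

/-! ### §1 Model-wise vocabulary -/

section Model

variable {p : ℕ} [Fact p.Prime] {k : Type} [Field k] [CharP k p] [PerfectRing k p]

/-- **Seed span at one model** (verbatim the ideator-1 typing `IdeatorOneSketch.SemiregularSeedSpanAt`):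
`α ∈ H²ʳ_dR(X_K/K)` lies in the `K`-span of the Berthelot–Ogus images of `chᵣ^cris` of finitely many finite
locally free, `{0,1}`-semiregular seeds on the special fibre satisfying the Bloch–Esnault–Kerz Hodge
condition at `𝒳`. -/
def SemiregularSeedSpanAt (C : CrystallineRealization p k) (𝒳 : SchemeOver (WittVector p k))
    (r : ℕ) (α : C.dR.obj (genericFibre 𝒳) (2 * r)) : Prop :=
  ∃ s : Finset (specialFibre 𝒳).left.Modules,
    (∀ E ∈ s, ∃ hE : IsFiniteLocallyFree E, IsZeroOneSemiregular hE ∧ C.HodgeCondition 𝒳 E) ∧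
    α ∈ Submodule.span K(p, k)
      ((fun E => C.bo 𝒳 (2 * r) (C.chCris (specialFibre 𝒳) E r)) '' (s : Set _))

/-- **Coherent class at one model**: `α` lies in the Hodge filtration step `Fʳ H²ʳ_dR(X_K/K)` and in the
image under the Berthelot–Ogus map of the `K`-span of crystalline Tate classes of the special fibre
(`φ x = pʳ x`). For `X₀` over a number field `F`, an `F`-rational de Rham class in a coherent plane
(`AdelicCoherence.DeRhamPlanes` + `FrobeniusPlanes`, after the finite extension making 'potentially Tate'
'Tate') gives such an `α` at every good place. -/
def IsCoherentAt (C : CrystallineRealization p k) (𝒳 : SchemeOver (WittVector p k)) (r : ℕ)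
    (α : C.dR.obj (genericFibre 𝒳) (2 * r)) : Prop :=
  α ∈ C.dR.fil (2 * r) r ∧
    α ∈ (Submodule.span K(p, k) (C.tateClasses (specialFibre 𝒳) r : Set _)).map (C.bo 𝒳 (2 * r))

/-- **The new stub, model-wise** (`NumberFieldSeeds` evaluated at the chosen place): at the `W(k)`-model `𝒳`
every coherent class of degree `2r` is seed-spanned. The card's number-field statement asks this at SOME
good place `v` of (a finite extension of) the number field, `k = 𝔽_v` FINITE (so that `span_K tateClasses`
is the genuine Frobenius eigenspace, TRIAGE-r1-2 §T1), for the coherent classes coming from `X₀/F`. -/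
def CoherentSeedsAt (C : CrystallineRealization p k) (𝒳 : SchemeOver (WittVector p k)) (r : ℕ) : Prop :=
  ∀ α : C.dR.obj (genericFibre 𝒳) (2 * r), IsCoherentAt C 𝒳 r α → SemiregularSeedSpanAt C 𝒳 r α

/-! ### §2 Necessity, and the engine output at one model -/

/-- **Seeds ⇒ coherent** (the stub asks nothing absurd): a seed-spanned class lies in `Fʳ` (Hodge condition
of each seed in degree `r`) and in `bo (K·Tate)` (`φ chᵣ = pʳ chᵣ`, `frobK_chCris`). -/
theorem isCoherentAt_of_seedSpan (C : CrystallineRealization p k) {n : ℕ}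
    {𝒳 : SchemeOver (WittVector p k)} (h𝒳 : IsSmoothProperModel n 𝒳) {r : ℕ}
    {α : C.dR.obj (genericFibre 𝒳) (2 * r)} (h : SemiregularSeedSpanAt C 𝒳 r α) :
    IsCoherentAt C 𝒳 r α := by
  obtain ⟨s, hs, hα⟩ := h
  refine ⟨(Submodule.span_le.mpr ?_) hα, (Submodule.span_le.mpr ?_) hα⟩
  · rintro _ ⟨E, hEs, rfl⟩
    obtain ⟨-, -, hH⟩ := hs E hEs
    exact hH r
  · rintro _ ⟨E, -, rfl⟩
    refine Submodule.mem_map_of_mem (Submodule.subset_span ?_)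
    exact C.frobK_chCris h𝒳.isSmoothProjective_specialFibre E r

/-- **Engine output at one model**: if every coherent class at `𝒳` is seed-spanned (`CoherentSeedsAt`) and
every `{0,1}`-semiregular seed with the Hodge condition LIFTS TO `𝒳` (the route's engine
P1b → P1a → P3a specialised to this model: `PadicPridhamSemiregularity` gives (⋆),
`FormalLiftingFromClassLifting` gives `LiftsFormally` from (⋆) + the BEK class lift supplied by the Hodge
condition, `FormalVectorBundlesAlgebraize` gives `LiftsTo`), then every coherent class is a `K`-combination
of `ℚ`-algebraic de Rham classes of the generic fibre — the conclusion of
`AdelicCoherence.CoherentClassesAlgebraic` at the place, before descent `K ⊃ F_v ⊃ F`. -/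
theorem coherent_mem_span_ratAlgebraicClasses (C : CrystallineRealization p k) {n : ℕ}
    {𝒳 : SchemeOver (WittVector p k)} (h𝒳 : IsSmoothProperModel n 𝒳) {r : ℕ}
    (hseeds : CoherentSeedsAt C 𝒳 r)
    (hlift : ∀ (E : (specialFibre 𝒳).left.Modules) (hE : IsFiniteLocallyFree E),
      IsZeroOneSemiregular hE → C.HodgeCondition 𝒳 E → LiftsTo 𝒳 E)
    {α : C.dR.obj (genericFibre 𝒳) (2 * r)} (hα : IsCoherentAt C 𝒳 r α) :
    α ∈ Submodule.span K(p, k)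
      (C.dR.ratAlgebraicClasses (genericFibre 𝒳) r : Set (C.dR.obj (genericFibre 𝒳) (2 * r))) := by
  obtain ⟨s, hs, hαs⟩ := hseeds α hα
  refine (Submodule.span_le.mpr ?_) hαs
  rintro _ ⟨E, hEs, rfl⟩
  obtain ⟨hE, hsr, hH⟩ := hs E hEs
  obtain ⟨E', hE', ⟨e⟩⟩ := hlift E hE hsr hH
  refine Submodule.subset_span ?_
  show C.bo 𝒳 (2 * r) (C.chCris (specialFibre 𝒳) E r) ∈
    (C.dR.ratAlgebraicClasses (genericFibre 𝒳) r : Set (C.dR.obj (genericFibre 𝒳) (2 * r)))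
  rw [← C.chCris_congr e r, C.bo_chCris h𝒳 E' hE' r]
  exact C.chDR_mem_ratAlgebraicClasses h𝒳.isSmoothProjective_genericFibre _ r

/-- **Where T(v) is free** (the card's Künneth / Hom-type calibration, class level): any class that is
ALREADY `ℚ`-algebraic on the special fibre is a Tate class there (`ratAlgebraicClasses_le_tateClasses`), so for
such reductions — Künneth projectors by Katz–Messing, Frobenius-polynomial Hom-classes — the Tate half of
`IsCoherentAt` costs nothing and the stub is purely the SEED half. -/
theorem bo_mem_map_span_tateClasses_of_ratAlgebraic (C : CrystallineRealization p k) {n : ℕ}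
    {𝒳 : SchemeOver (WittVector p k)} (h𝒳 : IsSmoothProperModel n 𝒳) {r : ℕ}
    {x : C.obj (specialFibre 𝒳) (2 * r)} (hx : x ∈ C.ratAlgebraicClasses (specialFibre 𝒳) r) :
    C.bo 𝒳 (2 * r) x ∈
      (Submodule.span K(p, k) (C.tateClasses (specialFibre 𝒳) r : Set _)).map (C.bo 𝒳 (2 * r)) :=
  Submodule.mem_map_of_mem
    (Submodule.subset_span (C.ratAlgebraicClasses_le_tateClasses h𝒳.isSmoothProjective_specialFibre r hx))

end Model

/-! ### §3 Wiring: the crux BY NAME from typed items of the summit -/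

open Summit.HodgeConjecture.HodgeConjecture.Theses in
/-- **The ℚ̄-funnel concludes the crux by name.** From QbarEnvelope's typed items `Envelope` (Voisin funnel),
`PullbackAlgebraic` (Fulton, in print), `HodgeModels` (PROVED in tree) and `HCOverNumberFields`, the remainder
crux `HodgeBeyondAnchors` follows (QbarEnvelope's deciding theorem gives the whole summit; restrict off the
anchors). This is the composition the dead line `Sketch` lacked; the card's NEW content enters only through
`HCOverNumberFields` (next two lemmas + §2). -/
theorem hodgeBeyondAnchors_of_funnel (hE : QbarEnvelope.Envelope) (hP : QbarEnvelope.PullbackAlgebraic)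
    (hM : QbarEnvelope.HodgeModels) (hC : QbarEnvelope.HCOverNumberFields) :
    PadicSemiregularLift.HodgeBeyondAnchors :=
  fun _ _ hX _ _ => QbarEnvelope.closes hE hC hP hM hX

open Summit.HodgeConjecture.HodgeConjecture.Theses
  Summit.HodgeConjecture.HodgeConjecture.Theorems.AnchorsAtGenericHodgeLocusPoints in
/-- **AdelicCoherence's target feeds QbarEnvelope's number-field crux**: HC for every `X₀ ⊗_ρ ℂ` with `X₀`
smooth projective over a number field (`AdelicCoherence.HodgeConjectureNumberFields`, decided there by
`DeRhamPlanes → FrobeniusPlanes → CoherentClassesAlgebraic`) gives `QbarEnvelope.HCOverNumberFields`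
(HC for every complex `X` ISOMORPHIC to such a base change), by transport of `IsSmoothProjective` and of
`HodgeConjectureFor` along the isomorphism — provided the number-field model is itself smooth projective of
dimension `n` over `K`, which we take as the (EGA IV descent) side hypothesis `hdesc` here (it is the content of
`AdelicCoherence.NumberFieldReduction`, known). -/
theorem hcOverNumberFields_of_hodgeConjectureNumberFields
    (hNF : AdelicCoherence.HodgeConjectureNumberFields)
    (hdesc : ∀ ⦃n : ℕ⦄ ⦃X : SchemeOver ℂ⦄, IsSmoothProjective n X →
      (∃ (K : Type) (_ : Field K) (_ : NumberField K) (σ : K →+* ℂ) (X₀ : SchemeOver K),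
        Nonempty (X ≅ (baseChangeHom σ).obj X₀)) →
      ∃ (K : Type) (_ : Field K) (_ : NumberField K) (σ : K →+* ℂ) (X₀ : SchemeOver K),
        IsSmoothProjective n X₀ ∧ Nonempty (X ≅ (baseChangeHom σ).obj X₀)) :
    QbarEnvelope.HCOverNumberFields := by
  intro n X hX hmodel
  obtain ⟨K, _, _, σ, X₀, hX₀, ⟨e⟩⟩ := hdesc hX hmodel
  have hXσ : IsSmoothProjective n ((baseChangeHom σ).obj X₀) := hX.of_iso e
  exact hodgeConjectureFor_of_iso hXσ hX e (hNF σ hX₀ hXσ)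

open Summit.HodgeConjecture.HodgeConjecture.Theses in
/-- **The card's Transfer, as one implication over typed decls** (shape of the skeleton a crux-plan seat would
register): granted the shared items of QbarEnvelope and AdelicCoherence's number-field target (to be got from
`DeRhamPlanes`, `FrobeniusPlanes`, the NEW object stub and the engine), the crux follows. -/
theorem transfer_shape (hE : QbarEnvelope.Envelope) (hP : QbarEnvelope.PullbackAlgebraic)
    (hM : QbarEnvelope.HodgeModels) (hNF : AdelicCoherence.HodgeConjectureNumberFields)
    (hdesc : ∀ ⦃n : ℕ⦄ ⦃X : SchemeOver ℂ⦄, IsSmoothProjective n X →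
      (∃ (K : Type) (_ : Field K) (_ : NumberField K) (σ : K →+* ℂ) (X₀ : SchemeOver K),
        Nonempty (X ≅ (baseChangeHom σ).obj X₀)) →
      ∃ (K : Type) (_ : Field K) (_ : NumberField K) (σ : K →+* ℂ) (X₀ : SchemeOver K),
        IsSmoothProjective n X₀ ∧ Nonempty (X ≅ (baseChangeHom σ).obj X₀)) :
    PadicSemiregularLift.HodgeBeyondAnchors :=
  hodgeBeyondAnchors_of_funnel hE hP hM (hcOverNumberFields_of_hodgeConjectureNumberFields hNF hdesc)

end

end Summit.HodgeConjecture.HodgeConjecture.Cruxes.HodgeBeyondAnchors.IdeatorFiveSketch
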